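import Mathlib
import HarnessLib
import Literature.MathematicalPhysics.StatisticalMechanics.TorusFRDFinalMultipliers

/-!
# The Fourier shell bounds of the finite-range decomposition in geometric form
# (Buchholz Thm 2.4 (v) / Adams–Buchholz–Kotecký–Müller Thm 6.1, (6.9)–(6.10))

Clause (v) of `GradientFRD.TorusFRD` bounds the Fourier coefficients of the kernels `𝒞_k` on the
dyadic shells `𝔸_{j'}` by expressions `c·L^{−(2(d+ñ)+1)}·L^{2j'}·L^{−(k−j')(d−1+n)} ≤ Re 𝒞̂_k(p)`,
`|𝒞̂_k(p)| ≤ C·L^{2(d+ñ)+1}·L^{2j'}·L^{−(k−j')(d−1+n)}` (`j' < k`), `c L^{−(2(d+ñ)+1)} L^{2k} ≤ Re 𝒞̂_k(p)`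
(`k ≤ j'`).  The scalar Lemma 7.3 of [ABKM19] (`WeightShellBounds.lean`,
`WeightDominatingStep.lean`) consumes them in the GEOMETRIC form
`c_low Lsq^{j'} B^{−(k−j')} ≤ c_k ≤ C_up Lsq^{j'} B^{−(k−j')}` with `Lsq = L²`, `B = L^{d−1+n}`,
`C_up = C L^{2(d+ñ)+1}`, `c_low = c L^{−(2(d+ñ)+1)}`.  This file performs the conversion for an
abstract family of coefficients satisfying the (v)-shaped hypothesis (`ShellBoundsV`), and records
the momentum facts of a shell used there (`inv_momNorm_sq_le_of_inShell`: `|p|^{−2} ≤ Lsq·Lsq^{j'}`).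

Everything is proved; no named fact.

## References
* S. Buchholz, J. Funct. Anal. 275 (2018), Thm 2.4 (v) [Buchholz2016].
* S. Adams, S. Buchholz, R. Kotecký, S. Müller, arXiv:1910.13564, Thm 6.1 (6.9)–(6.10), Lemma 7.3
  (7.35), (7.37) [AdamsBuchholzKoteckyMuller2019].
-/

noncomputable section

namespace Literature.MathematicalPhysics.StatisticalMechanics.GradientFRD

open Finset
open scoped Real

variable {d M : ℕ}

/-- **The (v)-shaped two-sided shell bounds** for a family `f k : ℂ` (the Fourier coefficients
`𝒞̂_k(p)` of the decomposition at a fixed mode `p ∈ 𝔸_{j'}`), `k ∈ [1, N+1]`: verbatim the shape of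
clause (v) of `GradientFRD.TorusFRD` (without the `s`-derivative bounds).
[cite: Buchholz2016, Thm 2.4 (v)] -/
def ShellBoundsV (d n ñ N j' : ℕ) (L c C : ℝ) (f : ℕ → ℂ) : Prop :=
  ∀ k, 1 ≤ k → k ≤ N + 1 →
    (j' < k →
      c / L ^ (2 * (d + ñ) + 1) * L ^ (2 * j') / L ^ ((k - j') * (d - 1 + n)) ≤ (f k).re ∧
        ‖f k‖ ≤ C * L ^ (2 * (d + ñ) + 1) * L ^ (2 * j') / L ^ ((k - j') * (d - 1 + n))) ∧
    (k ≤ j' → c / L ^ (2 * (d + ñ) + 1) * L ^ (2 * k) ≤ (f k).re ∧ ‖f k‖ ≤ C * L ^ (2 * k))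

namespace ShellBoundsV

variable {n ñ N j' : ℕ} {L c C : ℝ} {f : ℕ → ℂ}

/-- Power bookkeeping: `L^{2j} = (L²)^j`. [cite: Buchholz2016, Thm 2.4 (v)] -/
theorem pow_two_mul (L : ℝ) (j : ℕ) : L ^ (2 * j) = (L ^ 2) ^ j := by rw [pow_mul]

/-- Power bookkeeping: `L^{(k−j)(d−1+n)} = (L^{d−1+n})^{k−j}`. [cite: Buchholz2016, Thm 2.4 (v)] -/
theorem pow_sub_mul (L : ℝ) (k j e : ℕ) : L ^ ((k - j) * e) = (L ^ e) ^ (k - j) := by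
  rw [mul_comm, pow_mul]

/-- **Upper bound in geometric form** for `k > j'`: `Re f_k ≤ C_up · Lsq^{j'} / B^{k−j'}` with
`C_up = C L^{2(d+ñ)+1}`, `Lsq = L²`, `B = L^{d−1+n}`. [cite: AdamsBuchholzKoteckyMuller2019, Thm 6.1 (6.9)] -/
theorem re_le_of_lt (h : ShellBoundsV d n ñ N j' L c C f) {k : ℕ} (hk1 : 1 ≤ k) (hkN : k ≤ N + 1)
    (hj'k : j' < k) :
    (f k).re ≤ (C * L ^ (2 * (d + ñ) + 1)) * (L ^ 2) ^ j' / (L ^ (d - 1 + n)) ^ (k - j') := by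
  have hb := ((h k hk1 hkN).1 hj'k).2
  rw [← pow_two_mul, ← pow_sub_mul]
  exact (Complex.re_le_norm _).trans hb

/-- **Lower bound in geometric form** for `k > j'`: `c_low · Lsq^{j'} / B^{k−j'} ≤ Re f_k` with
`c_low = c / L^{2(d+ñ)+1}`. [cite: AdamsBuchholzKoteckyMuller2019, Thm 6.1 (6.10)] -/
theorem le_re_of_lt (h : ShellBoundsV d n ñ N j' L c C f) {k : ℕ} (hk1 : 1 ≤ k) (hkN : k ≤ N + 1)
    (hj'k : j' < k) :
    (c / L ^ (2 * (d + ñ) + 1)) * (L ^ 2) ^ j' / (L ^ (d - 1 + n)) ^ (k - j') ≤ (f k).re := by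
  have hb := ((h k hk1 hkN).1 hj'k).1
  rwa [← pow_two_mul, ← pow_sub_mul]

/-- **Lower bound in geometric form** for `k ≤ j'`: `c_low · Lsq^{k} ≤ Re f_k`.
[cite: AdamsBuchholzKoteckyMuller2019, Thm 6.1 (6.10)] -/
theorem le_re_of_le (h : ShellBoundsV d n ñ N j' L c C f) {k : ℕ} (hk1 : 1 ≤ k) (hkN : k ≤ N + 1)
    (hkj' : k ≤ j') : (c / L ^ (2 * (d + ñ) + 1)) * (L ^ 2) ^ k ≤ (f k).re := by
  have hb := ((h k hk1 hkN).2 hkj').1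
  rwa [← pow_two_mul]

/-- Non-negativity of the real parts off the zero mode (from the lower bounds, `c ≥ 0`, `L ≥ 0`).
[cite: AdamsBuchholzKoteckyMuller2019, Thm 6.1 (6.10)] -/
theorem re_nonneg (h : ShellBoundsV d n ñ N j' L c C f) (hc : 0 ≤ c) (hL : 0 ≤ L) {k : ℕ}
    (hk1 : 1 ≤ k) (hkN : k ≤ N + 1) : 0 ≤ (f k).re := by
  rcases lt_or_ge j' k with hlt | hle
  · exact le_trans (by positivity) (le_re_of_lt h hk1 hkN hlt)
  · exact le_trans (by positivity) (le_re_of_le h hk1 hkN hle)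

end ShellBoundsV

/-- The kernels of `TorusFRD` extended by zero outside `[1, N+1]`: the coefficient family
`cExt f k = Re f_k` for `1 ≤ k ≤ N+1` and `0` otherwise (so that tails over all `k > j'` make sense).
[cite: AdamsBuchholzKoteckyMuller2019, Thm 6.1] -/
def cExt (N : ℕ) (f : ℕ → ℂ) (k : ℕ) : ℝ :=
  if 1 ≤ k ∧ k ≤ N + 1 then (f k).re else 0

/-- `cExt` on the range. [cite: AdamsBuchholzKoteckyMuller2019, Thm 6.1] -/
theorem cExt_of_mem {N : ℕ} {f : ℕ → ℂ} {k : ℕ} (hk1 : 1 ≤ k) (hkN : k ≤ N + 1) :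
    cExt N f k = (f k).re := if_pos ⟨hk1, hkN⟩

/-- **The hypothesis `hU` of `WeightShellBounds.tail_sum_le`** from the (v)-bounds: for all `k > j'`,
`cExt k ≤ C_up Lsq^{j'}/B^{k−j'}` (`C, L ≥ 0`). [cite: AdamsBuchholzKoteckyMuller2019, Lemma 7.3 (7.35)] -/
theorem cExt_le_of_shellBoundsV {n ñ N j' : ℕ} {L c C : ℝ} {f : ℕ → ℂ}
    (h : ShellBoundsV d n ñ N j' L c C f) (hC : 0 ≤ C) (hL : 0 ≤ L) (k : ℕ) (hj'k : j' < k) :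
    cExt N f k ≤ (C * L ^ (2 * (d + ñ) + 1)) * (L ^ 2) ^ j' / (L ^ (d - 1 + n)) ^ (k - j') := by
  unfold cExt
  split_ifs with hk
  · exact ShellBoundsV.re_le_of_lt h hk.1 hk.2 hj'k
  · positivity

/-- `cExt ≥ 0` everywhere (for `c, L ≥ 0`). [cite: AdamsBuchholzKoteckyMuller2019, Thm 6.1 (6.10)] -/
theorem cExt_nonneg {n ñ N j' : ℕ} {L c C : ℝ} {f : ℕ → ℂ} (h : ShellBoundsV d n ñ N j' L c C f)
    (hc : 0 ≤ c) (hL : 0 ≤ L) (k : ℕ) : 0 ≤ cExt N f k := by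
  unfold cExt
  split_ifs with hk
  · exact ShellBoundsV.re_nonneg h hc hL hk.1 hk.2
  · exact le_rfl

/-! ## Momentum facts of a shell -/

/-- **`|p|^{−2} ≤ Lsq · Lsq^{j'}`** on the shell `𝔸_{j'}` (`Lsq = L²`, `L ≥ 1`): from `L^{−(j'+1)} < |p|`.
[cite: AdamsBuchholzKoteckyMuller2019, Lemma 7.3 (7.37)] -/
theorem inv_momNorm_sq_le_of_inShell [NeZero M] {L : ℕ} (hL : 1 ≤ L) {j' : ℕ} {κ : Fin d → ZMod M}
    (hj : InShell L j' κ) : (momNorm κ ^ 2)⁻¹ ≤ (L : ℝ) ^ 2 * ((L : ℝ) ^ 2) ^ j' := by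
  have hlt := lt_momNorm_of_inShell hj
  have hL0 : (0 : ℝ) < (L : ℝ) ^ (j' + 1) := pow_pos (by exact_mod_cast (show 0 < L by omega)) _
  have hp : 0 < momNorm κ := lt_trans (inv_pos.2 hL0) hlt
  have h1 : (momNorm κ)⁻¹ < (L : ℝ) ^ (j' + 1) := by
    have := inv_strictAnti₀ (inv_pos.2 hL0) hlt
    rwa [inv_inv] at this
  have h2 : (momNorm κ ^ 2)⁻¹ = (momNorm κ)⁻¹ ^ 2 := by rw [inv_pow]
  rw [h2]
  have h3 : ((L : ℝ) ^ (j' + 1)) ^ 2 = (L : ℝ) ^ 2 * ((L : ℝ) ^ 2) ^ j' := by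
    rw [← pow_mul, ← pow_mul, ← pow_add]; ring_nf
  rw [← h3]
  exact pow_le_pow_left₀ (inv_nonneg.2 hp.le) h1.le 2

/-- **`|p| ≤ L^{−j'}`** on the shell `𝔸_{j'}` for `j' ≥ 1`, and `|p| ≤ √d·π` always (so the bound
(7.38) applies with `ρ = max(L^{−j'}, √dπ)`-type radii). [cite: AdamsBuchholzKoteckyMuller2019, Lemma 7.3 (7.38)] -/
theorem momNorm_le_inv_pow_of_inShell [NeZero M] {L : ℕ} (hL : 1 ≤ L) {j' : ℕ} (hj'1 : 1 ≤ j')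
    {κ : Fin d → ZMod M} (hj : InShell L j' κ) : momNorm κ ≤ ((L : ℝ) ^ j')⁻¹ :=
  momNorm_le_of_inShell hL hj hj'1 le_rfl

end Literature.MathematicalPhysics.StatisticalMechanics.GradientFRD

end
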